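import Literature.Computability.AlgebraicComplexity.DGIJLLiftingAssembly
import Literature.Computability.AlgebraicComplexity.MultiplicityObstructionsProofs
import HarnessLib

/-!
# Dutta–Gesmundo–Ikenmeyer–Jindal–Lysikov Thm. 4.10, unconditional: the power sum is not in the
# orbit closure of product-plus-power

Theorem-only companion (no definitions, no named facts) of
`ProductPlusPowerObstructions.lean` (the named fact `DGIJL2025_thm_4_10` — P. Dutta, F. Gesmundo,
C. Ikenmeyer, G. Jindal, V. Lysikov, *Geometric complexity theory for product-plus-power*,
J. Symbolic Comput. (2025) 102458 = arXiv:2211.07055, Thm. 4.10 (p. 24): "Let `d ≥ 3` be even, and let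
`λ := (5d-1,1)+((d+1) × (10d))`. Then we have representation theoretic multiplicity obstructions:
`mult_λ(ℂ[\overline{GL_{d+1} P^{[d]}_{1,1}}]) ≤ 4 < 5 = mult_λ(ℂ[\overline{GL_{d+1} (x₁^d + ⋯ + x_{d+1}^d)}])`,
and hence `\overline{GL_{d+1} (x₁^d + ⋯ + x_{d+1}^d)} ⊄ \overline{GL_{d+1} P^{[d]}_{1,1}}`.") and of its
kernel consequences `dgijl2025_isMultiplicityObstructionAt`, `dgijl2025_psum_not_mem_orbitClosure`,
which were stated there CONDITIONALLY on `(h : DGIJL2025_thm_4_10)` and on the multiplicity-obstruction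
principle `(hprin : orbitMultiplicity_le_of_mem_orbitClosure)`.

Both hypotheses are now theorems of the tree — `DGIJL2025_thm_4_10_holds`
(`DGIJLLiftingAssembly.lean`, cell `val-lit` seat p6: DGIJL Prop. 4.12 by five explicit tableau
highest-weight vectors with a lower-triangular evaluation matrix, plus the tree's two upper bounds
`DGIJL2025_thm_4_10_of_five_le`) and `orbitMultiplicity_le_of_mem_orbitClosure_holds`
(`MultiplicityObstructionsProofs.lean`) — so this file records the two results UNCONDITIONALLY:

* `dgijl2025_isMultiplicityObstructionAt_unconditional`: for every even `d ≥ 3`, the weight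
  `λ* = (15d-1, 10d+1, (10d)^{d-1})*` IS a multiplicity obstruction against
  `x₀^d + ⋯ + x_d^d ∈ Δ_d[P^{[d]}_{1,1}]` (`IsMultiplicityObstructionAt`);
* `dgijl2025_psum_not_mem_orbitClosure_unconditional`: for every even `d ≥ 3`,
  `x₀^d + ⋯ + x_d^d ∉ Δ_d[P^{[d]}_{1,1}] = \overline{GL_{d+1} · (x₁⋯x_d + x₀^d)}`.

HONEST FRAMING. A kernel-checked instance of a printed representation-theoretic separation in the
toy model "power sum versus product-plus-power" (border Waring rank / GCT for `P^{[d]}_{1,1}`); it says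
nothing about permanent versus determinant, and VP ≠ VNP is not proved here or anywhere in the tree.

## References

* P. Dutta, F. Gesmundo, C. Ikenmeyer, G. Jindal, V. Lysikov, *Geometric complexity theory for
  product-plus-power*, J. Symbolic Comput. (2025) 102458 = arXiv:2211.07055, §4.3 Thm. 4.10,
  Prop. 4.11, Prop. 4.12. [cite: DuttaGesmundoIkenmeyerJindalLysikovJSC2025, Thm. 4.10]
* M. Bläser, C. Ikenmeyer, *Introduction to geometric complexity theory* (lecture notes, 2025),
  §12.4 (the multiplicity-obstruction principle). [cite: BlaeserIkenmeyer2025, §12.4]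

## Tree

`DGIJL2025_thm_4_10_holds` (`DGIJLLiftingAssembly`), `orbitMultiplicity_le_of_mem_orbitClosure_holds`
(`MultiplicityObstructionsProofs`), `dgijl2025_isMultiplicityObstructionAt`,
`dgijl2025_psum_not_mem_orbitClosure`, `productPlusPower`, `dgijlPartition`
(`ProductPlusPowerObstructions`). Standard axioms; no `native_decide`.
-/

noncomputable section

open MvPolynomial

namespace Literature.Computability.AlgebraicComplexity

open Literature.NumberTheory.DiophantineGeometry

/-- **DGIJL 2025 Thm. 4.10, the obstruction — unconditional.** For every even `d ≥ 3` the weight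
`λ* = (Weight.dualOfPartition (d+1) (dgijlPartition d _))`, `λ = (15d-1, 10d+1, (10d)^{d-1})`, is a
multiplicity obstruction against `x₀^d + ⋯ + x_d^d ∈ Δ_d[P^{[d]}_{1,1}]`:
`mult_{λ*} ℂ[Δ_d[P^{[d]}_{1,1}]] ≤ 4 < 5 = mult_{λ*} ℂ[Δ_d[x₀^d + ⋯ + x_d^d]]` ("we have representation
theoretic multiplicity obstructions"); `dgijl2025_isMultiplicityObstructionAt` fed the discharged fact
`DGIJL2025_thm_4_10_holds`. [cite: DuttaGesmundoIkenmeyerJindalLysikovJSC2025, Thm. 4.10] -/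
theorem dgijl2025_isMultiplicityObstructionAt_unconditional {d : ℕ} (hd : 3 ≤ d) (he : Even d) :
    IsMultiplicityObstructionAt (productPlusPower ℂ d) (psum (Fin (d + 1)) ℂ d) d
      (Weight.dualOfPartition (d + 1) (dgijlPartition d (zero_lt_three.trans_le hd))) :=
  dgijl2025_isMultiplicityObstructionAt DGIJL2025_thm_4_10_holds hd he

/-- **DGIJL 2025 Thm. 4.10, the separation — unconditional.** For every even `d ≥ 3`,
`x₀^d + ⋯ + x_d^d ∉ Δ_d[P^{[d]}_{1,1}]` ("and hence
`\overline{GL_{d+1}(x₁^d + ⋯ + x_{d+1}^d)} ⊄ \overline{GL_{d+1} P^{[d]}_{1,1}}`"):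
`dgijl2025_psum_not_mem_orbitClosure` fed `DGIJL2025_thm_4_10_holds` and the proved
multiplicity-obstruction principle `orbitMultiplicity_le_of_mem_orbitClosure_holds`.
[cite: DuttaGesmundoIkenmeyerJindalLysikovJSC2025, Thm. 4.10] -/
theorem dgijl2025_psum_not_mem_orbitClosure_unconditional {d : ℕ} (hd : 3 ≤ d) (he : Even d) :
    psum (Fin (d + 1)) ℂ d ∉ orbitClosure (productPlusPower ℂ d) :=
  dgijl2025_psum_not_mem_orbitClosure DGIJL2025_thm_4_10_holds
    orbitMultiplicity_le_of_mem_orbitClosure_holds hd he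

/-- The separation in orbit-closure-containment form, as printed ("and hence
`\overline{GL_{d+1} (x₁^d + ⋯ + x_{d+1}^d)} ⊄ \overline{GL_{d+1} P^{[d]}_{1,1}}`"): for every even
`d ≥ 3`, `Δ_d[x₀^d + ⋯ + x_d^d] ⊄ Δ_d[P^{[d]}_{1,1}]` (the power sum lies in its own orbit closure,
`mem_orbitClosure_self`). [cite: DuttaGesmundoIkenmeyerJindalLysikovJSC2025, Thm. 4.10] -/
theorem dgijl2025_orbitClosure_psum_not_subset_unconditional {d : ℕ} (hd : 3 ≤ d) (he : Even d) :
    ¬ orbitClosure (psum (Fin (d + 1)) ℂ d) ⊆ orbitClosure (productPlusPower ℂ d) :=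
  fun h => dgijl2025_psum_not_mem_orbitClosure_unconditional hd he (h (mem_orbitClosure_self _))

end Literature.Computability.AlgebraicComplexity

end
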